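import Literature.MathematicalPhysics.QuantumFieldTheory.Balaban1983to89.B16Sect1Statements
import Literature.MathematicalPhysics.QuantumFieldTheory.Balaban1983to89.Step

/-!
# `Balaban1983to89.B16Lem366Coupling` — T. Bałaban, *Large field renormalization. II. Localization, exponentiation,
and bounds for the 𝐑 operation*, Commun. Math. Phys. **122** (1989) 355–392 [Balaban1989LargeFieldII], Sect. 1
p. 366: the coupling-difference clause of the bound on the second term of (1.37) (SKELETON row **B16.Lem@366**,
decl of record `B16Sect1Statements.CouplingDiff366`) PROVED from the renormalization group equations (0.20) of
[I] = [Balaban1987RG1] and the printed boundedness of the β-functions (kind «implication / knitting», Phase 2 of the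
mega-formalization `lit-balaban`, reader/typer block r13 gen 6; HOME `run/shared/lean/pub/lit-balaban/`, rows
`lit-balaban-r13/ROWS-B16.md`).

statement-level skeleton of published theorems with citation tags; proofs where landed; nothing here is a claim about
the Yang–Mills mass gap

PDF held: `paper:balaban1989-cmp122-large-field-ii` (journal page = PDF page + 354); p. 366 [PDF 12] (render
`run/shared/lean/pub/pub-balaban/b2b-balaban-ref1/pages/1989-cmp122-large-field-II/…-p012-x2.png` read as an image by
r13 gen 2 for `B16Sect1Statements`).

WHAT IS REPRODUCED.  p. 366, verbatim: *"The second term is in fact a small term, because 1/(g″_k(·))² − 1/g_k² = O(N)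
≦ O(R_k) on the support of ζ,"* — on `supp ζ ⊂ Z` the coupling function `1/(g″_k(·))²` of (1.33)–(1.35)/p. 365 takes,
plaquette by plaquette, one of the values `1/g_m²` of the last `N` scales, `k − N ≦ m ≦ k` (condition (ii) of [IV] §1:
only the last `N` steps are glued in `Z`); the clause is then the telescoped RG equation (0.20) [I]
`1/g_m² − 1/g_k² = Σ_{j=m}^{k−1} β_{j+1}(g_j)` (`Step.inv_sq_telescope`) with *"β_{j+1} … uniformly bounded on this
interval"* ([I] p. 264; the two-sided shape `|β_j| ≦ β′` of `Step.SFHyp.betaBound`).  PROVED: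
`abs_inv_sq_sub_inv_sq_le` (`|1/g_m² − 1/g_n²| ≦ β′(n − m)`), **`couplingDiff366_of_rg`** (= `CouplingDiff366 (1/g_m²)
g_k β′ N` for `k − N ≦ m ≦ k`), the `Setup.Flow` form `couplingDiff366_of_flow`, the tower form
`couplingDiff366_of_sfHyp` (from `Step.SFHyp` + the interval hypothesis), and the plaquette-wise form
`couplingDiff366_scaleMap` for a coupling function `p ↦ 1/g_{m(p)}²` with `m(p) ∈ [k − N, k]` on `supp ζ`.  The second
half of the row (the numerical bound `Ineq366`/`Ineq366final` on the term itself) is not touched.  Theorems only;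
Mathlib + `B16Sect1Statements` + `Step`; no `sorry`.
-/

namespace Literature.MathematicalPhysics.QuantumFieldTheory.Balaban1983to89.B16Lem366Coupling

open Literature.MathematicalPhysics.QuantumFieldTheory.Balaban1983to89
open Step B16Sect1Statements Finset

/-! ## §1. Telescoped RG equations with bounded β-functions -/

/-- `|1/g_m² − 1/g_n²| ≦ β′(n − m)` for `m ≦ n ≦ K`, from the RG equations (0.20) [I] (`Step.RGEq`, telescoped by
`Step.inv_sq_telescope`), the interval hypothesis `0 < g_j ≦ γ` and the two-sided bound `|β_j(x)| ≦ β′` on `]0, γ]`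
([I] p. 264 *"uniformly bounded on this interval"*). [cite: Balaban1989LargeFieldII, p.366 (after (1.37))] -/
theorem abs_inv_sq_sub_inv_sq_le {K : ℕ} {β : ℕ → ℝ → ℝ} {g : ℕ → ℝ} {β' γ : ℝ} (h : RGEq K β g)
    (hI : InInterval γ K g) (hB : ∀ j x, 0 < x → x ≤ γ → |β j x| ≤ β') {m n : ℕ} (hmn : m ≤ n)
    (hn : n ≤ K) : |1 / (g m) ^ 2 - 1 / (g n) ^ 2| ≤ β' * ((n : ℝ) - m) := by
  rw [inv_sq_telescope h hmn hn, add_sub_cancel_left]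
  calc |∑ j ∈ Ico m n, β (j + 1) (g j)| ≤ ∑ j ∈ Ico m n, |β (j + 1) (g j)| := abs_sum_le_sum_abs _ _
    _ ≤ ∑ _j ∈ Ico m n, β' := by
        refine sum_le_sum fun j hj => ?_
        have hjK : j ≤ K := le_trans (le_of_lt (mem_Ico.mp hj).2) hn
        exact hB (j + 1) (g j) (hI j hjK).1 (hI j hjK).2
    _ = β' * ((n : ℝ) - m) := by
        rw [sum_const, Nat.card_Ico, nsmul_eq_mul, Nat.cast_sub hmn]
        ring

/-- `β′ ≧ 0` under the two-sided bound (the interval `]0, γ]` contains `g_0`). [cite: Balaban1989LargeFieldII, p.366 (after (1.37))] -/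
theorem betaBound_nonneg {K : ℕ} {β : ℕ → ℝ → ℝ} {g : ℕ → ℝ} {β' γ : ℝ} (hI : InInterval γ K g)
    (hB : ∀ j x, 0 < x → x ≤ γ → |β j x| ≤ β') : 0 ≤ β' :=
  (abs_nonneg _).trans (hB 1 (g 0) (hI 0 (Nat.zero_le K)).1 (hI 0 (Nat.zero_le K)).2)

/-! ## §2. Row B16.Lem@366, the coupling clause `1/(g″_k(·))² − 1/g_k² = O(N)` -/

/-- **Row B16.Lem@366 (coupling clause) PROVED**: for every scale `m` of the last `N` steps, `k − N ≦ m ≦ k ≦ K`, the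
value `1/g_m²` of the coupling function satisfies `B16Sect1Statements.CouplingDiff366 (1/g_m²) g_k β′ N`, i.e.
`|1/g_m² − 1/g_k²| ≦ β′·N` — *"1/(g″_k(·))² − 1/g_k² = O(N)"* with the `O(·)` = the β-bound `β′`.
[cite: Balaban1989LargeFieldII, p.366 (after (1.37))] -/
theorem couplingDiff366_of_rg {K : ℕ} {β : ℕ → ℝ → ℝ} {g : ℕ → ℝ} {β' γ : ℝ} (h : RGEq K β g)
    (hI : InInterval γ K g) (hB : ∀ j x, 0 < x → x ≤ γ → |β j x| ≤ β') {k m N : ℕ} (hk : k ≤ K)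
    (hmk : m ≤ k) (hN : k ≤ m + N) : CouplingDiff366 (1 / (g m) ^ 2) (g k) β' N := by
  unfold CouplingDiff366
  have hβ := betaBound_nonneg hI hB
  have hkm : (k : ℝ) - m ≤ N := by
    have : (k : ℝ) ≤ m + N := by exact_mod_cast hN
    linarith
  exact (abs_inv_sq_sub_inv_sq_le h hI hB hmk hk).trans (mul_le_mul_of_nonneg_left hkm hβ)

/-- `O(N) ≦ O(R_k)`: with the p. 361 window `N ≦ R_k` (`B16Sect1Kernels.NWindowUpper`) the clause reads
`|1/g_m² − 1/g_k²| ≦ β′R_k` (r13 gen 2 `couplingDiff366_le_Rk`, now unconditional in the flow model).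
[cite: Balaban1989LargeFieldII, p.366 (after (1.37))] -/
theorem abs_inv_sq_sub_le_Rk {K : ℕ} {β : ℕ → ℝ → ℝ} {g : ℕ → ℝ} {β' γ Rk : ℝ} (h : RGEq K β g)
    (hI : InInterval γ K g) (hB : ∀ j x, 0 < x → x ≤ γ → |β j x| ≤ β') {k m N : ℕ} (hk : k ≤ K)
    (hmk : m ≤ k) (hN : k ≤ m + N) (hW : B16Sect1Kernels.NWindowUpper N Rk) :
    |1 / (g m) ^ 2 - 1 / (g k) ^ 2| ≤ β' * Rk :=
  couplingDiff366_le_Rk (betaBound_nonneg hI hB) (couplingDiff366_of_rg h hI hB hk hmk hN) hW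

/-- The same in the `Setup.Flow` vocabulary (`Flow.SatisfiesRG` = (0.20), `Flow.InInterval`).
[cite: Balaban1989LargeFieldII, p.366 (after (1.37))] -/
theorem couplingDiff366_of_flow (F : Flow) {K : ℕ} {β' γ : ℝ} (h : F.SatisfiesRG K) (hI : F.InInterval γ K)
    (hB : ∀ j x, 0 < x → x ≤ γ → |F.β j x| ≤ β') {k m N : ℕ} (hk : k ≤ K) (hmk : m ≤ k)
    (hN : k ≤ m + N) : CouplingDiff366 (1 / (F.g m) ^ 2) (F.g k) β' N :=
  couplingDiff366_of_rg ((rgEq_iff F K).mp h) ((inInterval_iff F γ K).mp hI) hB hk hmk hN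

/-- The same from the SMALL-FIELD INDUCTIVE HYPOTHESES of [I] at scale `k` (`Step.SFHyp T c k`: its clauses `rg` =
(0.20) for `j < k` and `betaBound` = *"uniformly bounded on this interval"* `|β_j| ≦ β′` on `[0, γ]`, `1 ≦ j ≦ k`)
together with the interval hypothesis `0 < g_j ≦ γ`, `j ≦ k` (and `β′ ≧ 0`, automatic once `k ≧ 1`).
[cite: Balaban1989LargeFieldII, p.366 (after (1.37))] -/
theorem couplingDiff366_of_sfHyp {P : Params} {G : Type*} [GaugeGroup G] {Φ 𝒢 : Type*}
    {T : SFTower P G Φ 𝒢} {c : SFConsts} {k : ℕ} (h : SFHyp T c k) (hI : T.flow.InInterval c.γ k)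
    (hβ : 0 ≤ c.β') {m N : ℕ} (hmk : m ≤ k) (hN : k ≤ m + N) :
    CouplingDiff366 (1 / (T.flow.g m) ^ 2) (T.flow.g k) c.β' N := by
  -- the RG equations up to `k` and a β-bound adapted to the indices that occur
  have hrg : RGEq k T.flow.β T.flow.g := fun j hj => h.rg j hj
  have hI' : InInterval c.γ k T.flow.g := (inInterval_iff T.flow c.γ k).mp hI
  unfold CouplingDiff366
  rw [inv_sq_telescope hrg hmk le_rfl, add_sub_cancel_left]
  have hkm : (k : ℝ) - m ≤ N := by
    have : (k : ℝ) ≤ m + N := by exact_mod_cast hN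
    linarith
  calc |∑ j ∈ Ico m k, T.flow.β (j + 1) (T.flow.g j)| ≤ ∑ j ∈ Ico m k, |T.flow.β (j + 1) (T.flow.g j)| :=
        abs_sum_le_sum_abs _ _
    _ ≤ ∑ _j ∈ Ico m k, c.β' := by
        refine sum_le_sum fun j hj => ?_
        have hjk : j < k := (mem_Ico.mp hj).2
        have hg := hI' j hjk.le
        exact h.betaBound (j + 1) (Nat.succ_le_succ (Nat.zero_le j)) hjk (T.flow.g j) ⟨hg.1.le, hg.2⟩
    _ = c.β' * ((k : ℝ) - m) := by
        rw [sum_const, Nat.card_Ico, nsmul_eq_mul, Nat.cast_sub hmk]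
        ring
    _ ≤ c.β' * N := mul_le_mul_of_nonneg_left hkm hβ

/-! ## §3. Plaquette-wise form on `supp ζ` -/

/-- Plaquette-wise form: if on `supp ζ` the coupling function `c(·) = 1/(g″_k(·))²` is glued from the couplings of the
last `N` scales — `c(p) = 1/g_{m(p)}²` with `k − N ≦ m(p) ≦ k` for every `p ∈ supp ζ` (the gluing (1.33)–(1.35) under
condition (ii) of [IV] §1) — then `CouplingDiff366 (c p) g_k β′ N` at every such plaquette.
[cite: Balaban1989LargeFieldII, p.366 (after (1.37))] -/
theorem couplingDiff366_scaleMap {K : ℕ} {β : ℕ → ℝ → ℝ} {g : ℕ → ℝ} {β' γ : ℝ} (h : RGEq K β g)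
    (hI : InInterval γ K g) (hB : ∀ j x, 0 < x → x ≤ γ → |β j x| ≤ β') {k N : ℕ} (hk : k ≤ K)
    {α : Type*} (S : Set α) (c : α → ℝ) (m : α → ℕ)
    (hc : ∀ p ∈ S, c p = 1 / (g (m p)) ^ 2 ∧ m p ≤ k ∧ k ≤ m p + N) :
    ∀ p ∈ S, CouplingDiff366 (c p) (g k) β' N := by
  intro p hp
  obtain ⟨hcp, hmk, hN⟩ := hc p hp
  rw [hcp]
  exact couplingDiff366_of_rg h hI hB hk hmk hN

end Literature.MathematicalPhysics.QuantumFieldTheory.Balaban1983to89.B16Lem366Coupling
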